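import Mathlib
import Literature.Probability.Percolation.Percolation
import Literature.Probability.Percolation.RSW
import Literature.Probability.Percolation.PlanarDuality
import Literature.Probability.Percolation.LayerPeeling
import HarnessLib

/-!
# Gluing two regions along a seam: connectivity of the union from the two one-sided patterns

Topic `Literature/Probability/Percolation`. Companion of `LayerPeeling.lean`; dictionary step (i)
of the named fact `Literature.Probability.Percolation.IkhlefPonsaingFirstPassage` (Ikhlef–Ponsaing,
J. Stat. Phys. 149 (2012), arXiv:1202.5476), where the passage probability is the pairing
`⟨Ψ|ρ|Ψ⟩/⟨Ψ|Ψ⟩` (Def. 4.1) of the link pattern BELOW a cut with the link pattern ABOVE it ("`⟨Ψ|`,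
the ground state of the rotated lattice, giving the relative probabilities of upward link
patterns", §3.1): the event at the cut is a function of the two one-sided patterns. Folklore graph
theory, stated for an arbitrary vertex type:

* `openConnIn_union_iff_eqvGen_glue` — regions `A₁`, `A₂`, a seam `F ⊆ A₁ ∩ A₂` such that no open
  edge joins `A₁ \ F` to `A₂ \ F`: two seam points are joined inside `A₁ ∪ A₂` iff they are
  equivalent under the closure of "joined inside `A₁`" ∪ "joined inside `A₂`" on the seam.
* `wall_union_iff_glue` — the same for "joined to some point satisfying `W`" (a wall).

Proof: induction along an open walk in `A₁ ∪ A₂`, which can change sides only through the seam.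
The instance for the diagonal strip (seam = a column, right pattern = left pattern of the
transposed configuration, IP12's `ρ` as a Boolean junction functional) is
`DiagonalStripJunction.lean`.

## References

* Y. Ikhlef, A. K. Ponsaing, J. Stat. Phys. 149 (2012) 10–36, arXiv:1202.5476, §3.1, Def. 4.1.
  [IkhlefPonsaing2012]
-/

namespace Literature.Probability.Percolation

section Glue

variable {V : Type*}

/-- The walk induction behind `openConnIn_union_iff_eqvGen_glue`. For regions `A₁`, `A₂` and
`F ⊆ A₁ ∩ A₂` such that no open edge joins `A₁ \\ F` to `A₂ \\ F`; along an open walk inside `A₁ ∪ A₂` ending in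
`F`, a start point in `F` is glue-equivalent to the end point, and a start point off `F` is joined
inside its own region to a point of `F` that is. [folklore] -/
private theorem glue_aux {ω : BondConfig V} {A₁ A₂ F : Set V} (hF₁ : F ⊆ A₁) (hF₂ : F ⊆ A₂)
    (hH : ∀ u ∈ A₁, u ∉ F → ∀ v ∈ A₂, v ∉ F → ¬ (openGraph ω).Adj u v)
    {u y : ↥(A₁ ∪ A₂)} (hy : (y : V) ∈ F) (p : ((openGraph ω).induce (A₁ ∪ A₂)).Walk u y) :
    ((u : V) ∈ F → Relation.EqvGen (fun f g : V =>
        f ∈ F ∧ g ∈ F ∧ (ω ∈ openConnIn A₁ f g ∨ ω ∈ openConnIn A₂ f g)) u y) ∧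
    ((u : V) ∉ F → (u : V) ∈ A₁ → ∃ f ∈ F, ω ∈ openConnIn A₁ u f ∧ Relation.EqvGen (fun f g : V =>
        f ∈ F ∧ g ∈ F ∧ (ω ∈ openConnIn A₁ f g ∨ ω ∈ openConnIn A₂ f g)) f y) ∧
    ((u : V) ∉ F → (u : V) ∈ A₂ → ∃ f ∈ F, ω ∈ openConnIn A₂ u f ∧ Relation.EqvGen (fun f g : V =>
        f ∈ F ∧ g ∈ F ∧ (ω ∈ openConnIn A₁ f g ∨ ω ∈ openConnIn A₂ f g)) f y) := by
  induction p with
  | nil =>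
    exact ⟨fun _ => Relation.EqvGen.refl _, fun h => absurd hy h, fun h => absurd hy h⟩
  | @cons u v w hadj p ih =>
    have hadj' : (openGraph ω).Adj (u : V) (v : V) := by
      rw [SimpleGraph.induce_adj] at hadj; exact hadj
    obtain ⟨ih₁, ih₂, ih₃⟩ := ih hy
    -- where is `v`?
    have hv3 : (v : V) ∈ F ∨ ((v : V) ∉ F ∧ (v : V) ∈ A₁) ∨ ((v : V) ∉ F ∧ (v : V) ∈ A₂) := by
      by_cases h : (v : V) ∈ F
      · exact Or.inl h
      · rcases v.2 with h' | h'
        · exact Or.inr (Or.inl ⟨h, h'⟩)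
        · exact Or.inr (Or.inr ⟨h, h'⟩)
    refine ⟨fun hu => ?_, fun hu huA => ?_, fun hu huA => ?_⟩
    · rcases hv3 with hv | ⟨hv, hvA⟩ | ⟨hv, hvA⟩
      · exact Relation.EqvGen.trans _ _ _ (Relation.EqvGen.rel _ _
          ⟨hu, hv, Or.inl (openConnIn_of_openGraph_adj (hF₁ hu) (hF₁ hv) hadj')⟩) (ih₁ hv)
      · obtain ⟨f, hf, hc, he⟩ := ih₂ hv hvA
        exact Relation.EqvGen.trans _ _ _ (Relation.EqvGen.rel _ _ ⟨hu, hf, Or.inl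
          (PlanarDuality.openConnIn_trans (openConnIn_of_openGraph_adj (hF₁ hu) hvA hadj') hc)⟩) he
      · obtain ⟨f, hf, hc, he⟩ := ih₃ hv hvA
        exact Relation.EqvGen.trans _ _ _ (Relation.EqvGen.rel _ _ ⟨hu, hf, Or.inr
          (PlanarDuality.openConnIn_trans (openConnIn_of_openGraph_adj (hF₂ hu) hvA hadj') hc)⟩) he
    · rcases hv3 with hv | ⟨hv, hvA⟩ | ⟨hv, hvA⟩
      · exact ⟨v, hv, openConnIn_of_openGraph_adj huA (hF₁ hv) hadj', ih₁ hv⟩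
      · obtain ⟨f, hf, hc, he⟩ := ih₂ hv hvA
        exact ⟨f, hf, PlanarDuality.openConnIn_trans (openConnIn_of_openGraph_adj huA hvA hadj') hc, he⟩
      · exact absurd hadj' (hH _ huA hu _ hvA hv)
    · rcases hv3 with hv | ⟨hv, hvA⟩ | ⟨hv, hvA⟩
      · exact ⟨v, hv, openConnIn_of_openGraph_adj huA (hF₂ hv) hadj', ih₁ hv⟩
      · exact absurd hadj'.symm (hH _ hvA hv _ huA hu)
      · obtain ⟨f, hf, hc, he⟩ := ih₃ hv hvA
        exact ⟨f, hf, PlanarDuality.openConnIn_trans (openConnIn_of_openGraph_adj huA hvA hadj') hc, he⟩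

/-- **Gluing two regions along a separating set.** Let `A₁`, `A₂` be regions, `F ⊆ A₁ ∩ A₂`, with
no open edge between `A₁ \\ F` and `A₂ \\ F`. Then two points of `F`
are joined by an open path inside `A₁ ∪ A₂` iff they are equivalent under the closure of "joined
inside `A₁`" ∪ "joined inside `A₂`" (restricted to `F`): the connectivity of the union along the
seam is determined by the two one-sided connectivity patterns of the seam. [folklore] -/
theorem openConnIn_union_iff_eqvGen_glue {ω : BondConfig V} {A₁ A₂ F : Set V} (hF₁ : F ⊆ A₁)
    (hF₂ : F ⊆ A₂)
    (hH : ∀ u ∈ A₁, u ∉ F → ∀ v ∈ A₂, v ∉ F → ¬ (openGraph ω).Adj u v) {x y : V} (hx : x ∈ F)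
    (hy : y ∈ F) :
    ω ∈ openConnIn (A₁ ∪ A₂) x y ↔ Relation.EqvGen (fun f g : V =>
        f ∈ F ∧ g ∈ F ∧ (ω ∈ openConnIn A₁ f g ∨ ω ∈ openConnIn A₂ f g)) x y := by
  constructor
  · rintro ⟨hx', hy', ⟨p⟩⟩
    exact (glue_aux hF₁ hF₂ hH (u := ⟨x, hx'⟩) (y := ⟨y, hy'⟩) hy p).1 hx
  · intro h
    suffices H : ∀ a b, Relation.EqvGen (fun f g : V =>
        f ∈ F ∧ g ∈ F ∧ (ω ∈ openConnIn A₁ f g ∨ ω ∈ openConnIn A₂ f g)) a b →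
        ((a ∈ F ↔ b ∈ F) ∧ (a ∈ F → ω ∈ openConnIn (A₁ ∪ A₂) a b)) from (H x y h).2 hx
    intro a b hab
    induction hab with
    | rel a b hr =>
      obtain ⟨ha, hb, hc | hc⟩ := hr
      · exact ⟨iff_of_true ha hb, fun _ => openConnIn_mono Set.subset_union_left a b hc⟩
      · exact ⟨iff_of_true ha hb, fun _ => openConnIn_mono Set.subset_union_right a b hc⟩
    | refl a => exact ⟨Iff.rfl, fun ha => ⟨Or.inl (hF₁ ha), Or.inl (hF₁ ha), SimpleGraph.Reachable.refl _⟩⟩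
    | symm a b _ ih => exact ⟨ih.1.symm, fun hb => openConnIn_symm' (ih.2 (ih.1.2 hb))⟩
    | trans a b c _ _ ih₁ ih₂ =>
      exact ⟨ih₁.1.trans ih₂.1, fun ha => PlanarDuality.openConnIn_trans (ih₁.2 ha) (ih₂.2 (ih₁.1.1 ha))⟩

/-- **Gluing, wall form.** Under the same hypotheses, a point `x ∈ F` is joined inside `A₁ ∪ A₂`
to some point satisfying `W` iff some glue-equivalent seam point is joined to such a point inside
`A₁` or inside `A₂`. [folklore] -/
theorem wall_union_iff_glue {ω : BondConfig V} {A₁ A₂ F : Set V} (hF₁ : F ⊆ A₁) (hF₂ : F ⊆ A₂)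
    (hH : ∀ u ∈ A₁, u ∉ F → ∀ v ∈ A₂, v ∉ F → ¬ (openGraph ω).Adj u v) (W : V → Prop) {x : V}
    (hx : x ∈ F) :
    (∃ w, W w ∧ ω ∈ openConnIn (A₁ ∪ A₂) x w) ↔
      ∃ f, f ∈ F ∧ Relation.EqvGen (fun f g : V =>
          f ∈ F ∧ g ∈ F ∧ (ω ∈ openConnIn A₁ f g ∨ ω ∈ openConnIn A₂ f g)) x f ∧
        ((∃ w, W w ∧ ω ∈ openConnIn A₁ f w) ∨ (∃ w, W w ∧ ω ∈ openConnIn A₂ f w)) := by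
  constructor
  · rintro ⟨w, hW, hconn⟩
    -- walk from `w` to `x`
    obtain ⟨hw', hx', ⟨p⟩⟩ := openConnIn_symm' hconn
    obtain ⟨c₁, c₂, c₃⟩ := glue_aux hF₁ hF₂ hH (u := ⟨w, hw'⟩) (y := ⟨x, hx'⟩) hx p
    by_cases hwF : w ∈ F
    · exact ⟨w, hwF, Relation.EqvGen.symm _ _ (c₁ hwF),
        Or.inl ⟨w, hW, ⟨hF₁ hwF, hF₁ hwF, SimpleGraph.Reachable.refl _⟩⟩⟩
    · rcases hw' with hwA | hwA
      · obtain ⟨f, hf, hc, he⟩ := c₂ hwF hwA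
        exact ⟨f, hf, Relation.EqvGen.symm _ _ he, Or.inl ⟨w, hW, openConnIn_symm' hc⟩⟩
      · obtain ⟨f, hf, hc, he⟩ := c₃ hwF hwA
        exact ⟨f, hf, Relation.EqvGen.symm _ _ he, Or.inr ⟨w, hW, openConnIn_symm' hc⟩⟩
  · rintro ⟨f, hf, he, hw⟩
    have hxf : ω ∈ openConnIn (A₁ ∪ A₂) x f :=
      (openConnIn_union_iff_eqvGen_glue hF₁ hF₂ hH hx hf).2 he
    rcases hw with ⟨w, hW, hc⟩ | ⟨w, hW, hc⟩
    · exact ⟨w, hW, PlanarDuality.openConnIn_trans hxf (openConnIn_mono Set.subset_union_left _ _ hc)⟩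
    · exact ⟨w, hW, PlanarDuality.openConnIn_trans hxf (openConnIn_mono Set.subset_union_right _ _ hc)⟩

end Glue

end Literature.Probability.Percolation
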